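import Summits.CriticalPhenomena.PercolationContinuityZ3.Theorems.PercNearOneGluingNoHeavyConstsMDLXJointMarkerClusterReduction
import HarnessLib

/-!
# The marker-cluster conjecture J_y and the reduction `J_y ⟹ MDL(X)′` (PAPER-2 track (ii); seat `prim-consts-2`, gen 17)

builds on p205010 (kernel theorem, internal audit signed; external expert review pending).  Support file (`--supports
stmt-CriticalPhenomena-4575`): one `Prop` definition (an OPEN statement of this programme, tagged `@[conjecture]`) and one theorem; no sorries;
standard axioms.  Memo `run/shared/lean/prim/consts/FROM-prim-consts-2-g17-CYLINDER-DUALITY.md` §8.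

Setting of `Consts.MDLXJoint` (MDL(X)′): owner `s`, avoided set `X`, markers `y ≠ s`, `z`, `D = {s↮X}`, `T = {y ↮ {s}∪X} ∩ D`, `W = {y↔z}`,
`ν = μ(·|D)`.  Let `L(ω) = V(C_y[G − s])(ω)` be the vertex set of the open cluster of `y` in the graph with the owner deleted, `A(ω) ⇔ s ↔ y`
(`⇔` some pair from `s` into `L(ω)` is open), `cls(ω) = {ω' | L(ω') = L(ω), A(ω') ⇔ A(ω)}` the MARKER CLASS of `ω`, and
`h̃ = ν(s↔z | cls) = μ(D ∩ {s↔z} ∩ cls)/μ(D ∩ cls)`.  The total-covariance formula over the classes splits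
`MDLX(F) = Cov_ν(F,1_Z) − p'·Cov_ν(F,1_Y)` (`p' = μ(T∩W)/μ(T)`) as `E_ν[Cov_ν(F, 1_Z | cls)] + J_y(F)` with
`J_y(F) = Cov_ν(F, h̃) − p'·Cov_ν(F, 1_Y)`; the first term is `≥ 0` for monotone `F` (`Consts.integral_mul_markerClassCond_le`: given the class,
`1_Y` is a constant and `C_s` off the class is the cluster of `s` in `G − L` repelled from `X`, where vdBHK Theorem 1.3 applies).

* `Consts.MarkerClusterBetween` — **CONJECTURE J_y (OPEN, this programme): `J_y(F) ≥ 0` for every monotone `F`**, in cleared-denominator form.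
  It is STRONGER than MDL(X)′ (by the theorem below) and was found as the between-class part of MDL(X)′; `h̃ − p'1_Y` is NOT monotone, so
  Harris–FKG does not apply.  EVIDENCE (exact rational arithmetic after a float screen, engine `kit/jy17` of seat prim-consts-2 gen 17,
  minimum over ALL up-closed families of edge clusters by min-cut): 0 violations on the EXHAUSTIVE tables n = 6 (all 112 connected graphs ×
  all placements of `(s,x,y,z)` × 3 weightings: 101 172 instances, kit job j188596) and n = 7, m ≤ 9 (all 218 connected graphs × all placements ×
  2 weightings: 276 504 instances, j188599), and on ≈ 8 000 random instances n ≤ 8 with `|X| ∈ {0,1,2}`; the sharp constant of J_y equals `p'`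
  exactly on the degenerate corner family where MDL(X)′ is tight.
* `Consts.mdlxJoint_of_markerClusterBetween` — **THEOREM: `MarkerClusterBetween → MDLXJoint`** (`Consts.mdlxJoint_of_markerBetween` pointwise in `F`).
[cite: VandenbergHaggstromKahn2005, Thm. 1.3 (p. 6), §1 pp. 7–8, §2.1 (pp. 9–13)]
-/

noncomputable section

namespace Summit.CriticalPhenomena.PercolationContinuityZ3.Theorems

open MeasureTheory Set Literature.Probability.LatticeModels Literature.Probability.Percolation
open scoped Classical

namespace Consts

/-- **Conjecture J_y (the between-class part of MDL(X)′; OPEN, this programme).**  For all `n`, weights `w`, owner `s`, markers `y ≠ s`, `z`,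
avoided set `X` and every monotone `F` of the open edge cluster of `s`:
`μ(T∩W)·(μ(D)·∫_{D∩{s↔y}} F − ∫_D F·μ(D∩{s↔y})) ≤ μ(T)·(μ(D)·∫_D F·h̃ − ∫_D F·∫_D h̃)`, where
`h̃(ω) = μ(D ∩ {s↔z} ∩ cls(ω))/μ(D ∩ cls(ω))` is the conditional probability of `s ↔ z` given `D` and the marker class
`cls(ω) = {ω' | V(C_y[G−s])(ω') = V(C_y[G−s])(ω) ∧ (s↔y in ω' ⇔ s↔y in ω)}` (`V(C_y[G−s])(ω) = {v | y ↔ v in ω ∖ {pairs at s}}`;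
`s ↔ y ⇔ ∃ u ∈ V(C_y[G−s]), s(s,u) open`).  Implies `Consts.MDLXJoint` (`Consts.mdlxJoint_of_markerClusterBetween`).  EVIDENCE: exhaustive exact
census n = 6 and n = 7 (m ≤ 9), all up-closed families, 0 violations (kit j188596, j188599; seat prim-consts-2 gen 17).
builds on p205010 (kernel theorem, internal audit signed; external expert review pending).
[cite: VandenbergHaggstromKahn2005, Thm. 1.3 (p. 6), §1 pp. 7–8] [status: open] -/
@[conjecture] def MarkerClusterBetween : Prop :=
  ∀ (n : ℕ) (w : Sym2 (Fin n) → unitInterval) (s y z : Fin n) (X : Set (Fin n)), s ≠ y →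
    ∀ F : Set (Sym2 (Fin n)) → ℝ, Monotone F →
    (prodBernoulli w).real ({ω : BondConfig (Fin n) | ∀ x ∈ insert s X, ¬ (openGraph ω).Reachable y x} ∩
          {ω : BondConfig (Fin n) | ∀ x ∈ X, ¬ (openGraph ω).Reachable s x} ∩ openConn y z) *
        ((prodBernoulli w).real {ω : BondConfig (Fin n) | ∀ x ∈ X, ¬ (openGraph ω).Reachable s x} *
            ∫ ω in {ω : BondConfig (Fin n) | ∀ x ∈ X, ¬ (openGraph ω).Reachable s x} ∩ openConn s y, F (openEdgeCluster ω s) ∂(prodBernoulli w) -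
          (∫ ω in {ω : BondConfig (Fin n) | ∀ x ∈ X, ¬ (openGraph ω).Reachable s x}, F (openEdgeCluster ω s) ∂(prodBernoulli w)) *
            (prodBernoulli w).real ({ω : BondConfig (Fin n) | ∀ x ∈ X, ¬ (openGraph ω).Reachable s x} ∩ openConn s y)) ≤
      (prodBernoulli w).real ({ω : BondConfig (Fin n) | ∀ x ∈ insert s X, ¬ (openGraph ω).Reachable y x} ∩
          {ω : BondConfig (Fin n) | ∀ x ∈ X, ¬ (openGraph ω).Reachable s x}) *
        ((prodBernoulli w).real {ω : BondConfig (Fin n) | ∀ x ∈ X, ¬ (openGraph ω).Reachable s x} *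
            ∫ ω in {ω : BondConfig (Fin n) | ∀ x ∈ X, ¬ (openGraph ω).Reachable s x}, F (openEdgeCluster ω s) *
              ((prodBernoulli w).real ({ω : BondConfig (Fin n) | ∀ x ∈ X, ¬ (openGraph ω).Reachable s x} ∩ openConn s z ∩ {ω' : BondConfig (Fin n) |
        {v : Fin n | (openGraph (ω' \ {e : Sym2 (Fin n) | s ∈ e})).Reachable y v} = {v : Fin n | (openGraph (ω \ {e : Sym2 (Fin n) | s ∈ e})).Reachable y v} ∧
        ((∃ u ∈ {v : Fin n | (openGraph (ω \ {e : Sym2 (Fin n) | s ∈ e})).Reachable y v}, s(s, u) ∈ ω') ↔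
          (∃ u ∈ {v : Fin n | (openGraph (ω \ {e : Sym2 (Fin n) | s ∈ e})).Reachable y v}, s(s, u) ∈ ω))}) /
      (prodBernoulli w).real ({ω : BondConfig (Fin n) | ∀ x ∈ X, ¬ (openGraph ω).Reachable s x} ∩ {ω' : BondConfig (Fin n) |
        {v : Fin n | (openGraph (ω' \ {e : Sym2 (Fin n) | s ∈ e})).Reachable y v} = {v : Fin n | (openGraph (ω \ {e : Sym2 (Fin n) | s ∈ e})).Reachable y v} ∧
        ((∃ u ∈ {v : Fin n | (openGraph (ω \ {e : Sym2 (Fin n) | s ∈ e})).Reachable y v}, s(s, u) ∈ ω') ↔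
          (∃ u ∈ {v : Fin n | (openGraph (ω \ {e : Sym2 (Fin n) | s ∈ e})).Reachable y v}, s(s, u) ∈ ω))})) ∂(prodBernoulli w) -
          (∫ ω in {ω : BondConfig (Fin n) | ∀ x ∈ X, ¬ (openGraph ω).Reachable s x}, F (openEdgeCluster ω s) ∂(prodBernoulli w)) *
            ∫ ω in {ω : BondConfig (Fin n) | ∀ x ∈ X, ¬ (openGraph ω).Reachable s x}, ((prodBernoulli w).real ({ω : BondConfig (Fin n) | ∀ x ∈ X, ¬ (openGraph ω).Reachable s x} ∩ openConn s z ∩ {ω' : BondConfig (Fin n) |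
        {v : Fin n | (openGraph (ω' \ {e : Sym2 (Fin n) | s ∈ e})).Reachable y v} = {v : Fin n | (openGraph (ω \ {e : Sym2 (Fin n) | s ∈ e})).Reachable y v} ∧
        ((∃ u ∈ {v : Fin n | (openGraph (ω \ {e : Sym2 (Fin n) | s ∈ e})).Reachable y v}, s(s, u) ∈ ω') ↔
          (∃ u ∈ {v : Fin n | (openGraph (ω \ {e : Sym2 (Fin n) | s ∈ e})).Reachable y v}, s(s, u) ∈ ω))}) /
      (prodBernoulli w).real ({ω : BondConfig (Fin n) | ∀ x ∈ X, ¬ (openGraph ω).Reachable s x} ∩ {ω' : BondConfig (Fin n) |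
        {v : Fin n | (openGraph (ω' \ {e : Sym2 (Fin n) | s ∈ e})).Reachable y v} = {v : Fin n | (openGraph (ω \ {e : Sym2 (Fin n) | s ∈ e})).Reachable y v} ∧
        ((∃ u ∈ {v : Fin n | (openGraph (ω \ {e : Sym2 (Fin n) | s ∈ e})).Reachable y v}, s(s, u) ∈ ω') ↔
          (∃ u ∈ {v : Fin n | (openGraph (ω \ {e : Sym2 (Fin n) | s ∈ e})).Reachable y v}, s(s, u) ∈ ω))})) ∂(prodBernoulli w))

/-- **J_y implies MDL(X)′.** [cite: VandenbergHaggstromKahn2005, Thm. 1.3 (p. 6), §1 pp. 7–8] -/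
theorem mdlxJoint_of_markerClusterBetween (h : MarkerClusterBetween) : MDLXJoint :=
  fun n w s y z X hsy F hF => mdlxJoint_of_markerBetween w s y z X hsy F hF (h n w s y z X hsy F hF)

end Consts

end Summit.CriticalPhenomena.PercolationContinuityZ3.Theorems

end
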